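import Summits.QuantumFields.YangMills.Theorems.ParabolicTrajectoryContinuumLimitOnTrajectoryDefsE

/-!
# Route `ParabolicTrajectory`, crux `ContinuumLimitOnTrajectory` (stmt-QuantumFields-10522): vocabulary of line `two-orbit-synchronisation`, part F (reshape v3.6, seat c4) — the restated crux with the volume-growth clause

Sixth route-posited vocabulary file of the line (lead `prover-line-stmt-QuantumFields-10522-c4-0`, seat c4; same
namespace as `…Defs`/`…DefsB`/`…DefsC`/`…DefsD`/`…DefsE`). Skeleton v3.5 (seat c3) is closed modulo four named
statements, one of which — `VolumeClause` (the crux's hypothesis block ⇒ `PolyVolumeGrowth sch`) — is not physics but the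
misstatement of (A) as typed (torus-seam report `Cruxes/ContinuumLimitOnTrajectory/SEAM-two-orbit-synchronisation.md`: the
block's only volume clause is `a_k L_k → ∞`, and along slow-volume admissible schemes the Schwartz tails wrapped around the
torus seam of the smearing box defeat the conclusion kinematically). `VolumeClause` speaks about the OLD block, so it stays
underivable after any restatement of (A); what a restated crux needs is the PER-SEQUENCE reduction with the growth clause
read from its own hypothesis block. This file types that restatement so the reduction can be landed against it now
(`…ReductionPVG`), NOTHING in §1 being asserted:
* §1 `ContinuumLimitOnTrajectoryPVG` — (A) VERBATIM with ONE extra hypothesis, the literal body of `PolyVolumeGrowth sch`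
  (`∃ N : ℕ, 1 ≤ N ∧ ∀ᶠ k in atTop, (sch.a k)⁻¹ ≤ (sch.a k * (sch.L k : ℝ)) ^ N`, physical torus half-side ≥ a power of the
  inverse spacing), inserted after `HasLatticeMassGap r sch Δ`; the recommended text of the planner's restatement (the three
  other natural renderings — `a_k⁻¹ ≤ a_k L_k`, `M^(2 n_k) ≤ L_k`, `a_k^{-δ} ≤ a_k L_k` — imply it: `…VolumeGlue`);
* §1 `ContinuumLimitWithGapPVG` — the same with the continuum gap clause `∃ Δ₁ > 0, T.HasMassGap Δ₁` of the witness appended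
  (what the line reaches in Cauchy–Schwarz currency, cf. `ContinuumLimitWithGap` of `…DefsE`);
* §2 glue (proved): `continuumLimitOnTrajectoryPVG_of_withGapPVG` (drop the gap clause);
  `continuumLimitOnTrajectoryPVG_of_crux` ((A) ⇒ (A_PVG): the restatement is a weakening, so nothing proved about (A) is
  lost); `continuumLimitOnTrajectory_of_volumeClause` and `continuumLimitWithGap_of_volumeClause` (`VolumeClause` + the
  PVG statement ⇒ the statement as typed) — so skeleton v3.6 factors the crux BY NAME as
  `stub_volume` + (A_PVG), and (A_PVG) is closed modulo `ChartExists`, `IRPhysicsCS`, `UVPhysics345` by `…ReductionPVG`.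
Refs: SEAM note §§3–4; `…DefsD` §1 (`VolumeClause`); `…DefsE`; `…VolumeGlue`; JaffeWitten2000 §6 (limits "as the volume
tends to infinity" — the rate is the statement's to fix).
-/

set_option autoImplicit false

open scoped SchwartzMap
open MeasureTheory Filter Topology
open Literature.MathematicalPhysics.QuantumFieldTheory Literature.MathematicalPhysics.QuantumLattice
open Literature.MathematicalPhysics.AQFT Literature.Probability.LatticeModels
open Summit.QuantumFields.YangMills.Theses.ParabolicTrajectory

noncomputable section

namespace Summit.QuantumFields.YangMills.Cruxes.ContinuumLimitOnTrajectory.TwoOrbitSynchronisation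

/-! ## §1 The restated crux (line-posited; NOT asserted) -/

/-- **(A_PVG) — crux (A) `ContinuumLimitOnTrajectory` restated with the volume-growth clause.** Verbatim the rev-4 body
of `Summit.QuantumFields.YangMills.Theses.ParabolicTrajectory.ContinuumLimitOnTrajectory` with ONE extra hypothesis after
`HasLatticeMassGap r sch Δ`: polynomial volume growth of the scheme, `∃ N ≥ 1, ∀ᶠ k, (a_k)⁻¹ ≤ (a_k L_k)^N` (the literal
body of `PolyVolumeGrowth sch`). For every compact simple `G`, lattice representation `r`, `M ≥ M₀`, `2 ≤ M`: `∃ θ₀ > 0`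
such that every `M`-adic Wilson scheme with `β_k → ∞`, convergent dimensionless curvature towers, `lim N_1 = θ ∈ (0, θ₀)`,
`HasLatticeMassGap r sch Δ` AND polynomial volume growth admits species renormalisations (same `a, β, L`) and OS data `T`
with `IsYangMillsFor r sch' T`, `T.IsNontrivial r.curvature`, `T.IsNonGaussian r.curvature`. The recommended restatement
of stmt-QuantumFields-10522 (seat c4); a weakening of (A) (`continuumLimitOnTrajectoryPVG_of_crux`). -/
def ContinuumLimitOnTrajectoryPVG : Prop :=
  ∀ (G : Type) [Group G] [TopologicalSpace G] [IsTopologicalGroup G] [CompactSpace G], IsCompactSimpleLieGroup G →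
    letI : MeasurableSpace G := borel G
    haveI : BorelSpace G := ⟨rfl⟩
    ∀ (r : LatticeRep G), ∃ M₀ : ℕ, ∀ M : ℕ, M₀ ≤ M → 2 ≤ M → ∃ θ₀ : ℝ, 0 < θ₀ ∧
      ∀ (θ Δ : ℝ) (sch : SpeciesScheme (YMSpecies G)) (n : ℕ → ℕ), 0 < θ → θ < θ₀ → 0 < Δ →
      (∀ k, sch.a k = ((M : ℝ) ^ n k)⁻¹) → Tendsto sch.β atTop atTop →
      (∀ t : ℕ, 0 < t → ∃ c : ℝ, Tendsto (fun k => ((M : ℝ) ^ n k) ^ 8 *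
        latticeConnectedCorr r.ρ (sch.β k) (sch.side k) r.curvature.F r.curvature.F (t * M ^ n k)) atTop (𝓝 c)) →
      Tendsto (fun k => ((M : ℝ) ^ n k) ^ 8 *
        latticeConnectedCorr r.ρ (sch.β k) (sch.side k) r.curvature.F r.curvature.F (M ^ n k)) atTop (𝓝 θ) →
      HasLatticeMassGap r sch Δ →
      (∃ N : ℕ, 1 ≤ N ∧ ∀ᶠ k in atTop, (sch.a k)⁻¹ ≤ (sch.a k * (sch.L k : ℝ)) ^ N) →
        ∃ sch' : SpeciesScheme (YMSpecies G), sch'.a = sch.a ∧ sch'.β = sch.β ∧ sch'.L = sch.L ∧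
          ∃ T : OSData (YMSpecies G) 4, IsYangMillsFor r sch' T ∧ T.IsNontrivial r.curvature ∧
            T.IsNonGaussian r.curvature

/-- **(A_PVG) with the continuum gap clause of the SAME witness appended**: under the restated hypothesis block the
renormalised scheme `sch'` and OS data `T` exist AND `T.HasMassGap Δ₁` for some `Δ₁ > 0` (the conclusion of
`…ReductionPVG.reductionPVG`: the Cauchy–Schwarz clustering input that feeds E4 also delivers the gap of the canonical
witness). Implies (A_PVG) (`continuumLimitOnTrajectoryPVG_of_withGapPVG`). -/
def ContinuumLimitWithGapPVG : Prop :=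
  ∀ (G : Type) [Group G] [TopologicalSpace G] [IsTopologicalGroup G] [CompactSpace G], IsCompactSimpleLieGroup G →
    letI : MeasurableSpace G := borel G
    haveI : BorelSpace G := ⟨rfl⟩
    ∀ (r : LatticeRep G), ∃ M₀ : ℕ, ∀ M : ℕ, M₀ ≤ M → 2 ≤ M → ∃ θ₀ : ℝ, 0 < θ₀ ∧
      ∀ (θ Δ : ℝ) (sch : SpeciesScheme (YMSpecies G)) (n : ℕ → ℕ), 0 < θ → θ < θ₀ → 0 < Δ →
      (∀ k, sch.a k = ((M : ℝ) ^ n k)⁻¹) → Tendsto sch.β atTop atTop →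
      (∀ t : ℕ, 0 < t → ∃ c : ℝ, Tendsto (fun k => ((M : ℝ) ^ n k) ^ 8 *
        latticeConnectedCorr r.ρ (sch.β k) (sch.side k) r.curvature.F r.curvature.F (t * M ^ n k)) atTop (𝓝 c)) →
      Tendsto (fun k => ((M : ℝ) ^ n k) ^ 8 *
        latticeConnectedCorr r.ρ (sch.β k) (sch.side k) r.curvature.F r.curvature.F (M ^ n k)) atTop (𝓝 θ) →
      HasLatticeMassGap r sch Δ →
      (∃ N : ℕ, 1 ≤ N ∧ ∀ᶠ k in atTop, (sch.a k)⁻¹ ≤ (sch.a k * (sch.L k : ℝ)) ^ N) →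
        ∃ sch' : SpeciesScheme (YMSpecies G), sch'.a = sch.a ∧ sch'.β = sch.β ∧ sch'.L = sch.L ∧
          ∃ T : OSData (YMSpecies G) 4, IsYangMillsFor r sch' T ∧ T.IsNontrivial r.curvature ∧
            T.IsNonGaussian r.curvature ∧ ∃ Δ₁ : ℝ, 0 < Δ₁ ∧ T.HasMassGap Δ₁

/-! ## §2 Glue (proved) -/

/-- `ContinuumLimitWithGapPVG` implies `ContinuumLimitOnTrajectoryPVG` (drop the gap clause). Registered glue of skeleton
v3.6. -/
theorem continuumLimitOnTrajectoryPVG_of_withGapPVG :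
    ContinuumLimitWithGapPVG → ContinuumLimitOnTrajectoryPVG := by
  intro h G _ _ _ _ hG
  letI : MeasurableSpace G := borel G
  haveI : BorelSpace G := ⟨rfl⟩
  intro r
  obtain ⟨M₀, hM₀⟩ := h G hG r
  refine ⟨M₀, fun M hM h2 => ?_⟩
  obtain ⟨θ₀, hθ₀, hall⟩ := hM₀ M hM h2
  refine ⟨θ₀, hθ₀, fun θ Δ sch n hθ hθθ hΔ hshape hβ htower htune hgap hgrowth => ?_⟩
  obtain ⟨sch', ha, hb, hL, T, hYM, hNT, hNG, -⟩ :=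
    hall θ Δ sch n hθ hθθ hΔ hshape hβ htower htune hgap hgrowth
  exact ⟨sch', ha, hb, hL, T, hYM, hNT, hNG⟩

/-- **The restatement is a weakening**: the crux as typed implies (A_PVG) (ignore the extra hypothesis). So every
negative-side theorem about (A_PVG) transfers to (A), and nothing proved FROM (A) is lost by proving (A_PVG) instead only
if the consumer can supply the clause — which the route's Assembly can once (S) `TunedSequenceExists` carries it in its
conclusion (the constructor of tuned sequences chooses the volumes). -/
theorem continuumLimitOnTrajectoryPVG_of_crux :
    ContinuumLimitOnTrajectory → ContinuumLimitOnTrajectoryPVG := by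
  intro h G _ _ _ _ hG
  letI : MeasurableSpace G := borel G
  haveI : BorelSpace G := ⟨rfl⟩
  intro r
  obtain ⟨M₀, hM₀⟩ := h G hG r
  refine ⟨M₀, fun M hM h2 => ?_⟩
  obtain ⟨θ₀, hθ₀, hall⟩ := hM₀ M hM h2
  exact ⟨θ₀, hθ₀, fun θ Δ sch n hθ hθθ hΔ hshape hβ htower htune hgap _ =>
    hall θ Δ sch n hθ hθθ hΔ hshape hβ htower htune hgap⟩

/-- **`VolumeClause` + (A_PVG) ⇒ the crux as typed.** Along a sequence of the old hypothesis block, `VolumeClause`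
supplies `PolyVolumeGrowth sch`, which is literally the extra hypothesis of (A_PVG). This is how skeleton v3.6 concludes
the crux BY NAME: the quarantined stub `stub_volume` and the restated statement, the latter closed modulo the chart and the
two physics inputs (`…ReductionPVG.continuumLimitOnTrajectoryPVG_of_inputs`). -/
theorem continuumLimitOnTrajectory_of_volumeClause :
    VolumeClause → ContinuumLimitOnTrajectoryPVG → ContinuumLimitOnTrajectory := by
  intro hvol h G _ _ _ _ hG
  letI : MeasurableSpace G := borel G
  haveI : BorelSpace G := ⟨rfl⟩
  intro r
  obtain ⟨M₀, hM₀⟩ := h G hG r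
  refine ⟨M₀, fun M hM h2 => ?_⟩
  obtain ⟨θ₀, hθ₀, hall⟩ := hM₀ M hM h2
  refine ⟨θ₀, hθ₀, fun θ Δ sch n hθ hθθ hΔ hshape hβ htower htune hgap => ?_⟩
  have hgrowth : PolyVolumeGrowth sch := hvol G hG r M θ Δ sch n hθ hΔ hshape hβ htower htune hgap
  exact hall θ Δ sch n hθ hθθ hΔ hshape hβ htower htune hgap hgrowth

/-- **`VolumeClause` + `ContinuumLimitWithGapPVG` ⇒ `ContinuumLimitWithGap`** (the v3.5 strengthened statement, same
mechanism). -/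
theorem continuumLimitWithGap_of_volumeClause :
    VolumeClause → ContinuumLimitWithGapPVG → ContinuumLimitWithGap := by
  intro hvol h G _ _ _ _ hG
  letI : MeasurableSpace G := borel G
  haveI : BorelSpace G := ⟨rfl⟩
  intro r
  obtain ⟨M₀, hM₀⟩ := h G hG r
  refine ⟨M₀, fun M hM h2 => ?_⟩
  obtain ⟨θ₀, hθ₀, hall⟩ := hM₀ M hM h2
  refine ⟨θ₀, hθ₀, fun θ Δ sch n hθ hθθ hΔ hshape hβ htower htune hgap => ?_⟩
  have hgrowth : PolyVolumeGrowth sch := hvol G hG r M θ Δ sch n hθ hΔ hshape hβ htower htune hgap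
  exact hall θ Δ sch n hθ hθθ hΔ hshape hβ htower htune hgap hgrowth

/-- The extra hypothesis of (A_PVG) IS `PolyVolumeGrowth sch` (definitional unfolding; recorded for consumers that hold the
clause in either spelling). -/
theorem polyVolumeGrowth_iff_clause {ι : Type} (sch : SpeciesScheme ι) :
    PolyVolumeGrowth sch ↔ ∃ N : ℕ, 1 ≤ N ∧ ∀ᶠ k in atTop, (sch.a k)⁻¹ ≤ (sch.a k * (sch.L k : ℝ)) ^ N :=
  Iff.rfl

end Summit.QuantumFields.YangMills.Cruxes.ContinuumLimitOnTrajectory.TwoOrbitSynchronisation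

end
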